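import Summits.HodgeConjecture.HodgeConjecture.Theorems.Ring2AbelianAllAndreCorrespondenceCategory
import Summits.HodgeConjecture.HodgeConjecture.Theorems.Ring2AbelianAllAndreLiebermanDischargedRows
import Summits.HodgeConjecture.HodgeConjecture.Theorems.Ring2AbelianAllLefschetzPencilsOnPath
import Summits.HodgeConjecture.HodgeConjecture.Theorems.Ring2AbelianAllLefschetzPencilsGraded
import Summits.HodgeConjecture.HodgeConjecture.Theorems.Ring2HypothesesDescentMotivatedAbelianPieces
import Literature.AlgebraicGeometry.HodgeTheory.VanishingCohomologyNontrivialProofs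
import HarnessLib

/-!
# Ring 2 — hypotheses layer, descent axis: row b05's modulus `X = B_pen` asks ONE polarisation per pencil —
# Kleiman's `ν`-criterion for `B⋆` on the real carriers, and `B⋆(X, η)` does not depend on `η`

HONEST FRAMING (page 1, verbatim the cell's standing line): **research route conditional on HC_CM; not a
corollary; Q11.4-sentence-2 already refuted in dim ≥ 3.** Nothing in this file proves a case of the Hodge
conjecture or of a standard conjecture beyond what the tree already has; nothing asserts `HC_CM`
(= `Theses.RankFourFaces.CMAbelianHodge`, a BINDER of the cell, referred to by name only, never restated),
`HC_AV` (= `Theses.PadicSemiregularLift.HodgeAbelianVarieties`), row b05 or its modulus `X`.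

Hodge ladder STAGE 3, `BINDER-OWNERS.md` row **b05** (`Ring2.Hypotheses.MotivatedImpliesAlgebraicAV`,
`Ring2HypothesesDescent.lean` l.177): "published modulo `X`", `X := Ring2.AbelianAll.CompactAbelianPencilLefschetz`
(`≡ LefschetzBCompactPencils`, `Ring2AbelianAllAndreJunction` (5∀)) — Grothendieck's `B`, in André's `⋆_L`-form
`StandardConjectureBStar (d + 1) 𝒳 η`, for the TOTAL SPACE `𝒳` of every compact pencil of abelian `d`-folds AND EVERY
`η ∈ H²(𝒳(ℂ); ℂ)` (every polarisation class of `𝒳`; vacuous otherwise). Until this file every kernel statement of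
`X`, of its graded pieces `(5∀)_d` and of its CM-pointed form (5) quantified over ALL polarisation classes of the
total space, and the tree had no theorem comparing `B⋆(Z, η)` for two polarisations of one `Z` (the layer
`HodgeTheory/MotivatedClasses` invokes André's §3.2 Remarque for the faithfulness of the span `motivatedClasses`
only). The AbelianAll sub-cell's part XXII-e
(`AbelianAll.IsAlgebraicCorrespondence.comp/.comp_lefschetzPow/.sum`: algebraic correspondences on the real
carriers form a `ℂ`-linear category, general smooth projective varieties) and part XXII-c §1
(`AbelianAll.exists_sum_smul_pow_comp_eq_id`, Cayley–Hamilton) now make the comparison a short kernel proof,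
for EVERY smooth projective complex variety:

* §1 **KLEIMAN'S `ν`-CRITERION, per degree** (`isAlgebraicCorrespondence_lefschetzInvolution_of_injective`): for
  `Z` smooth projective of dimension `n`, `η` ANY polarisation class and `b + r = n`, ONE injective linear map
  `F : H^{b+2r}(Z(ℂ)) → Hᵇ(Z(ℂ))` induced by an algebraic correspondence forces `*_{L,η} = (Lʳ_η)⁻¹ : H^{b+2r} → Hᵇ`
  to be induced by an algebraic correspondence (`w := F ∘ Lʳ_η` is an injective algebraic endomorphism of `Hᵇ`,
  `w⁻¹ ∘` is a polynomial in `w`, `θ := w⁻¹ F` is algebraic with `θ Lʳ = id`). Hence (`standardConjectureBStar_iff_nu`)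
  **`B⋆(Z, η) ⟺ ν(Z)`** := "for `2 ≤ b`, `b + r = n`, `0 < r` there is an injective algebraic correspondence
  `H^{b+2r}(Z(ℂ)) → Hᵇ(Z(ℂ))`" — Kleiman's form `ν(X)` of the Lefschetz standard conjecture (Kleiman 1994, Thm. 4-1:
  `ν(X) ⇔ θ(X) ⇔ B(X)`; Milne 2020b, proof of Prop. 4.1: "it suffices to show that, for each `i ≤ d`, there exists an
  algebraic correspondence inducing an isomorphism `H^{2d-i}(X) → Hⁱ(X)` ([Kleiman 1994], 4-1, `ν(X) ⇔ B(X)`)"),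
  on the tree's real carriers and sharpened by the free degrees `b ≤ 1` of `standardConjectureBStar_iff_inverseLefschetz`.
* §2 **`B⋆(Z, η)` DOES NOT DEPEND ON `η`** (`standardConjectureBStar_of_isPolarizationClass`): `B⋆(Z, η₀)` for ONE
  polarisation class `η₀` gives `B⋆(Z, η)` for every `η` (André 1996, Appendix A p. 44: "l'involution de Lefschetz est
  donnée par une correspondance algébrique (ceci ne dépend pas du choix de la polarisation de `X`, cf. [Kl68])"; the
  proof is André's §3.2 Remarque, p. 21, with "algébrique" for "motivé": "`(L'^{d-i})⁻¹ …` s'exprime comme polynôme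
  … en `πⁱ (L')^{d-i} *_L π^{2d-i}` (Cayley–Hamilton)"); so "`∀ η, B⋆(Z, η)`" ⟺ "`∃` a polarisation class `η₀` with
  `B⋆(Z, η₀)`" (`forall_standardConjectureBStar_iff_exists`; a polarisation class exists by the tree's hard
  Lefschetz theorem `nonempty_hardLefschetzNFold_holds`).
* §3 **ROW b05's MODULUS.** `X ⟺` "every compact abelian pencil total space has ONE polarisation class `η₀` with
  `B⋆(𝒳, η₀)`" `⟺ ν_pen` := "for every compact pencil of abelian `d`-folds and every `2 ≤ b ≤ d` there is an injective
  algebraic correspondence `H^{2d+2-b}(𝒳(ℂ)) → Hᵇ(𝒳(ℂ))`" (`compactAbelianPencilLefschetz_iff_exists_isPolarizationClass`,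
  `compactAbelianPencilLefschetz_iff_nu`; the same for the spelling `LefschetzBCompactPencils`, for the graded nodes
  `(5∀)_d` — at `d = 2`: ONE injective algebraic `H⁴(𝒳) → H²(𝒳)` per pencil of abelian surfaces — and for the
  CM-pointed node (5)). Consequently row b05 `⟸ ν_pen` modulo the two printed binders `h₂₁ h₂₂` of the landed bridge
  `X ⟹ b05` (`Ring2AbelianAllLefschetzPencilsOnPath` :123 with `h₈ := AbelianAll.abdulali1994_holds`, part XXII-d);
  row b05 `⟸ ν(A × Y)` for all complex abelian `A` and smooth projective `Y` (gen 31's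
  `motivatedImpliesAlgebraicAV_of_standardConjectureBStar_abelian_tensor` asked `B⋆(A ⊗ Y, η)` for EVERY `η`); and the
  Lefschetz-flavoured cell deliverable reads `HC_CM ∧ ν_pen^CM ⟹ HC_AV` modulo `h₂₁` only (part XXII-d's
  `HC_AV_of_HC_CM_of_lefschetzBCMPointedPencils`), `HC_CM` load-bearing and named only.

HONEST COLUMN. Nothing is discharged: `X`, `ν_pen`, `(5∀)_d` (`d ≥ 2`), row b05 stay OPEN; `BINDER-OWNERS.md` «10 · 0»
does not move; `ν_pen` is `X` restated (an `Iff`), not a weaker node. What is new is kernel-level SHAPE: the modulus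
of row b05 is an existence statement for injective algebraic correspondences in the degrees `(2d+2-b, b)`,
`2 ≤ b ≤ d`, of the `(d+1)`-fold total spaces — free of polarisations, of `*_L`, and of hard-Lefschetz inverses —
which is the form in which the known cases of `B` are proved (Lieberman/Kleiman 2A11: the Fourier correspondence,
part XXII-c; for an abelian scheme `𝒳 → S` a relative Fourier–Mukai / Pontryagin correspondence supported on
`𝒳 ×_S 𝒳 ⊂ 𝒳 × 𝒳` is a candidate `F` — NOT constructed, NOT claimed). NOT CLAIMED: `B` stable under products (Kleiman 1968 Cor. to 2A11 /
Kleiman 1994 4-1 via `Λ_{X×Y} = Λ_X ⊗ 1 + 1 ⊗ Λ_Y`; needs Künneth on the carriers), `ν` with "injective" weakened to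
"non-zero", anything about non-abelian-pencil varieties beyond §1–§2, the converse `HC_AV ⟹ X`.

References (bib keys): Kleiman1994StandardConjectures (Thm. 4-1: the forms `B`, `θ`, `ν` and their equivalence;
cite-only, acq-01066), Kleiman1968AlgebraicCycles (§2; Appendix, proof of Thm. 2A11), Andre1996Motifs (§3.2 Remarque
p. 21; Appendix A p. 44; §6.3 Remarque 2 p. 33), Milne2020LefschetzStandardFiniteFields = arXiv:2011.06563 (proof of Prop. 4.1;
Rem. 6.3), Grothendieck1968 (§3 p. 196), Lieberman1968, VoisinHodgeI2002 (Thm. 6.25).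
-/

noncomputable section

set_option linter.dupNamespace false

open CategoryTheory AlgebraicGeometry MonoidalCategory CartesianMonoidalCategory
open Literature.AlgebraicTopology.SingularHomology Literature.Geometry.Kaehler
open Literature.AlgebraicGeometry Literature.AlgebraicGeometry.Motives
open Literature.AlgebraicGeometry.HodgeTheory
open Literature.AlgebraicGeometry.Deligne1982 (cmLocus)
open Literature.AlgebraicGeometry.Andre1996 (andre1996_cmAnchoredPencil
  andre1996_cmHodgeClasses_algebraicallyAnchoredPencils)
open Summit.HodgeConjecture.HodgeConjecture.Theses
open Summit.HodgeConjecture.HodgeConjecture.Ring2.AbelianAll (exists_sum_smul_pow_comp_eq_id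
  CompactAbelianPencilLefschetz LefschetzBCompactPencils LefschetzBCMPointedPencils LefschetzBCompactPencilsAtRelDim
  abdulali1994_holds HC_AV_of_HC_CM_of_lefschetzBCMPointedPencils
  motivatedImpliesAlgebraicAV_of_abdulali_of_andre1996_of_compactAbelianPencilLefschetz_holds)

namespace Summit.HodgeConjecture.HodgeConjecture.Ring2.Hypotheses

/-! ## §1 Kleiman's `ν`-criterion: ONE injective algebraic correspondence `H^{b+2r} → Hᵇ` makes `*_L` algebraic there -/

section Nu

variable {n : ℕ} {X : SchemeOver ℂ}

/-- **Kleiman's `ν ⟹ θ` in one degree, on the real carriers.** Let `X` be smooth projective of dimension `n`, `η` a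
polarisation class, `b + r = n`. If there is SOME injective linear map `F : H^{b+2r}(X(ℂ); ℂ) → Hᵇ(X(ℂ); ℂ)` induced by
an algebraic correspondence, then André's `*_L = (Lʳ_η)⁻¹ : H^{b+2r} → Hᵇ` is induced by an algebraic correspondence:
`w := F ∘ Lʳ_η` is an injective algebraic endomorphism of the finite-dimensional `Hᵇ`, so `(Σ_k d_k wᵏ) ∘ w = id` for
suitable `d_k` (Cayley–Hamilton, part XXII-c `exists_sum_smul_pow_comp_eq_id`), `θ := Σ_k d_k (wᵏ ∘ F)` is algebraic
(part XXII-e: compositions and linear combinations of algebraic correspondences are algebraic) and `θ ∘ Lʳ = id`, i.e.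
`θ = (Lʳ)⁻¹ = *_L` (`Lʳ` onto by hard Lefschetz). This is the abstract core of Kleiman's proof of Lieberman's theorem
(2A11, where `F` is the Fourier correspondence of an abelian variety; part XXII-c) and of André's §3.2 Remarque
("`(L'^{d-i})⁻¹ …` s'exprime comme polynôme … (Cayley–Hamilton)"). No named fact.
[cite: Kleiman1994StandardConjectures, Thm. 4-1 (ν(X) ⇔ θ(X) ⇔ B(X))]
[cite: Kleiman1968AlgebraicCycles, Appendix to §2, proof of Thm. 2A11] [cite: Andre1996Motifs, §3.2 Remarque (p. 21)] -/
theorem isAlgebraicCorrespondence_lefschetzInvolution_of_injective (hX : IsSmoothProjective n X)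
    {η : complexBetti X 2} (hη : IsPolarizationClass n X η) {b r : ℕ} (hbr : b + r = n)
    (hab : b + 2 * r + b = 2 * n) {F : complexBetti X (b + 2 * r) →ₗ[ℂ] complexBetti X b}
    (hF : IsAlgebraicCorrespondence n n X X F) (hFinj : Function.Injective F) :
    IsAlgebraicCorrespondence n n X X (lefschetzInvolution hη.hasHardLefschetz hab) := by
  have hL : HasHardLefschetzProperty η n := hη.hasHardLefschetz
  have hLbij : Function.Bijective (lefschetzPow η r b) := hL r b hbr
  -- `w = F ∘ Lʳ`, an injective algebraic endomorphism of `Hᵇ`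
  set w : complexBetti X b →ₗ[ℂ] complexBetti X b := F ∘ₗ lefschetzPow η r b with hwdef
  have hw : IsAlgebraicCorrespondence n n X X w :=
    AbelianAll.IsAlgebraicCorrespondence.comp_lefschetzPow hX hX hη.mem_algebraicClasses b r hF
  have hwinj : Function.Injective w := by
    intro x x' h
    exact hLbij.1 (hFinj h)
  -- Cayley–Hamilton: `(Σ d_k w^k) ∘ w = id`
  haveI := finite_complexBetti hX b
  obtain ⟨s, d, hinv⟩ := exists_sum_smul_pow_comp_eq_id w hwinj
  -- each `w^k ∘ F` is an algebraic correspondence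
  have hpow : ∀ k : ℕ, IsAlgebraicCorrespondence n n X X ((w ^ k) ∘ₗ F) := by
    intro k
    induction k with
    | zero => rwa [pow_zero, Module.End.one_eq_id, LinearMap.id_comp]
    | succ k ih =>
      rw [pow_succ', Module.End.mul_eq_comp, LinearMap.comp_assoc]
      exact AbelianAll.IsAlgebraicCorrespondence.comp hX hX hX ih hw (by omega)
  have hθ : IsAlgebraicCorrespondence n n X X (∑ k ∈ s, d k • ((w ^ k) ∘ₗ F)) :=
    AbelianAll.IsAlgebraicCorrespondence.sum hX hX s d (fun k ↦ (w ^ k) ∘ₗ F) hpow 0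
  -- `θ = *_L`: both are left inverses of the surjective `Lʳ`
  have heq : lefschetzInvolution hL hab = ∑ k ∈ s, d k • ((w ^ k) ∘ₗ F) := by
    refine LinearMap.ext fun y ↦ ?_
    obtain ⟨x, rfl⟩ := hLbij.2 y
    rw [lefschetzInvolution_lefschetzPow hL hbr hab x]
    have h := LinearMap.congr_fun hinv x
    rw [LinearMap.comp_apply, LinearMap.id_apply] at h
    conv_lhs => rw [← h]
    simp only [LinearMap.sum_apply, LinearMap.smul_apply, LinearMap.comp_apply, hwdef]
  rw [heq]
  exact hθ

/-- **`ν(X) ⟹ B⋆(X, η)` for EVERY `η`** (Kleiman 1994 Thm. 4-1, `ν ⇒ B`, on the real carriers): if for all `2 ≤ b`,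
`b + r = n`, `0 < r` some injective linear map `H^{b+2r}(X(ℂ)) → Hᵇ(X(ℂ))` is induced by an algebraic correspondence,
then `StandardConjectureBStar n X η` for every `η ∈ H²(X(ℂ); ℂ)` — the degrees `a ≤ n`, `b ≤ 1` are the layer's free
ones (`standardConjectureBStar_iff_inverseLefschetz`), the degrees `n < a`, `2 ≤ b` are §1's criterion. The hypothesis
does not mention `η`. [cite: Kleiman1994StandardConjectures, Thm. 4-1 (ν(X) ⇔ B(X))]
[cite: Kleiman1968AlgebraicCycles, §2 and Appendix, Thm. 2A11] -/
theorem standardConjectureBStar_of_nu (hX : IsSmoothProjective n X)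
    (hν : ∀ b r : ℕ, 2 ≤ b → b + r = n → 0 < r →
      ∃ F : complexBetti X (b + 2 * r) →ₗ[ℂ] complexBetti X b,
        IsAlgebraicCorrespondence n n X X F ∧ Function.Injective F)
    (η : complexBetti X 2) : StandardConjectureBStar n X η := by
  refine (standardConjectureBStar_iff_inverseLefschetz hX η).2 fun hη a b hab ha hb ↦ ?_
  obtain ⟨r, rfl⟩ : ∃ r, a = b + 2 * r := ⟨n - b, by omega⟩
  obtain ⟨F, hF, hFinj⟩ := hν b r hb (by omega) (by omega)
  exact isAlgebraicCorrespondence_lefschetzInvolution_of_injective hX hη (by omega) hab hF hFinj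

/-- **`B⋆(X, η) ⟹ ν(X)`** for a polarisation class `η` (the easy half of Kleiman's `ν ⇔ B`): `*_{L,η} : H^{b+2r} → Hᵇ`
itself is a bijective map induced by an algebraic correspondence. [cite: Kleiman1994StandardConjectures, Thm. 4-1]
[cite: Andre1996Motifs, §0.2 (p. 7) and §1.1 (p. 10)] -/
theorem nu_of_standardConjectureBStar {η : complexBetti X 2} (hη : IsPolarizationClass n X η)
    (hB : StandardConjectureBStar n X η) (b r : ℕ) (hbr : b + r = n) :
    ∃ F : complexBetti X (b + 2 * r) →ₗ[ℂ] complexBetti X b,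
      IsAlgebraicCorrespondence n n X X F ∧ Function.Injective F :=
  ⟨lefschetzInvolution hη.hasHardLefschetz (show b + 2 * r + b = 2 * n by omega), hB hη _ _ _,
    (lefschetzInvolution_bijective hη.hasHardLefschetz _).1⟩

/-- **Kleiman's `ν(X) ⟺ B(X)` on the real carriers**: for `X` smooth projective of dimension `n` and `η` a
polarisation class, `StandardConjectureBStar n X η` holds iff for all `2 ≤ b`, `b + r = n`, `0 < r` some injective
linear map `H^{b+2r}(X(ℂ)) → Hᵇ(X(ℂ))` is induced by an algebraic correspondence. The right-hand side is free of
`η`, of `*_L` and of hard-Lefschetz inverses. [cite: Kleiman1994StandardConjectures, Thm. 4-1 (ν(X) ⇔ B(X))]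
[cite: Kleiman1968AlgebraicCycles, §2 and Appendix, Thm. 2A11] -/
theorem standardConjectureBStar_iff_nu (hX : IsSmoothProjective n X) {η : complexBetti X 2}
    (hη : IsPolarizationClass n X η) :
    StandardConjectureBStar n X η ↔
      ∀ b r : ℕ, 2 ≤ b → b + r = n → 0 < r →
        ∃ F : complexBetti X (b + 2 * r) →ₗ[ℂ] complexBetti X b,
          IsAlgebraicCorrespondence n n X X F ∧ Function.Injective F :=
  ⟨fun hB b r _ hbr _ ↦ nu_of_standardConjectureBStar hη hB b r hbr, fun hν ↦ standardConjectureBStar_of_nu hX hν η⟩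

end Nu

/-! ## §2 `B⋆(X, η)` does not depend on the polarisation -/

section Independence

variable {n : ℕ} {X : SchemeOver ℂ}

/-- **The standard conjecture `B` (André's `⋆_L`-form) does not depend on the polarisation** (André 1996, Appendix A:
"ceci ne dépend pas du choix de la polarisation de `X`, cf. [Kl68]"; §3.2 Remarque for the Cayley–Hamilton argument):
for `X` smooth projective of dimension `n`, if `StandardConjectureBStar n X η₀` holds for ONE polarisation class `η₀`,
it holds for every `η ∈ H²(X(ℂ); ℂ)` — `ν(X)` (§1) is supplied by `*_{L,η₀}`. Fact-free.
[cite: Andre1996Motifs, Appendix A (p. 44) and §3.2 Remarque (p. 21)] [cite: Kleiman1994StandardConjectures, Thm. 4-1]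
[cite: Kleiman1968AlgebraicCycles, §2] -/
theorem standardConjectureBStar_of_isPolarizationClass (hX : IsSmoothProjective n X) {η₀ : complexBetti X 2}
    (hη₀ : IsPolarizationClass n X η₀) (h₀ : StandardConjectureBStar n X η₀) (η : complexBetti X 2) :
    StandardConjectureBStar n X η :=
  standardConjectureBStar_of_nu hX (fun b r _ hbr _ ↦ nu_of_standardConjectureBStar hη₀ h₀ b r hbr) η

/-- **Every smooth projective complex variety carries a polarisation class** (the hyperplane class of the tree's hard
Lefschetz datum `nonempty_hardLefschetzNFold_holds`: a non-zero rational multiple of `[H]`, Voisin I Thm. 6.25, Rem.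
6.27, §7.1.2). [cite: VoisinHodgeI2002, Thm. 6.25, Rem. 6.27 and §7.1.2] -/
theorem exists_isPolarizationClass_of_isSmoothProjective (hX : IsSmoothProjective n X) :
    ∃ η : complexBetti X 2, IsPolarizationClass n X η := by
  obtain ⟨Λ⟩ := nonempty_hardLefschetzNFold_holds n X hX
  exact ⟨Λ.hyperplaneClass, Λ.isPolarizationClass⟩

/-- **"`B⋆(X, η)` for all `η`" ⟺ "`B⋆(X, η₀)` for ONE polarisation class `η₀`"** (`X` smooth projective of dimension
`n`; a polarisation class exists, `exists_isPolarizationClass_of_isSmoothProjective`).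
[cite: Andre1996Motifs, Appendix A (p. 44)] [cite: Kleiman1994StandardConjectures, Thm. 4-1] -/
theorem forall_standardConjectureBStar_iff_exists (hX : IsSmoothProjective n X) :
    (∀ η : complexBetti X 2, StandardConjectureBStar n X η) ↔
      ∃ η₀ : complexBetti X 2, IsPolarizationClass n X η₀ ∧ StandardConjectureBStar n X η₀ := by
  refine ⟨fun h ↦ ?_, fun ⟨η₀, hη₀, h₀⟩ η ↦ standardConjectureBStar_of_isPolarizationClass hX hη₀ h₀ η⟩
  obtain ⟨η₀, hη₀⟩ := exists_isPolarizationClass_of_isSmoothProjective hX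
  exact ⟨η₀, hη₀, h η₀⟩

/-- **"`B⋆(X, η)` for all `η`" ⟺ `ν(X)`** (`X` smooth projective of dimension `n`).
[cite: Kleiman1994StandardConjectures, Thm. 4-1 (ν(X) ⇔ B(X))] -/
theorem forall_standardConjectureBStar_iff_nu (hX : IsSmoothProjective n X) :
    (∀ η : complexBetti X 2, StandardConjectureBStar n X η) ↔
      ∀ b r : ℕ, 2 ≤ b → b + r = n → 0 < r →
        ∃ F : complexBetti X (b + 2 * r) →ₗ[ℂ] complexBetti X b,
          IsAlgebraicCorrespondence n n X X F ∧ Function.Injective F := by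
  refine ⟨fun h b r _ hbr _ ↦ ?_, fun hν η ↦ standardConjectureBStar_of_nu hX hν η⟩
  obtain ⟨η₀, hη₀⟩ := exists_isPolarizationClass_of_isSmoothProjective hX
  exact nu_of_standardConjectureBStar hη₀ (h η₀) b r hbr

end Independence

/-! ## §3 Row b05's modulus `X = B_pen`: one polarisation per pencil; Kleiman's `ν` for the pencil total spaces -/

section Pencils

/-- **`X ⟺` ONE polarisation class per pencil**: `CompactAbelianPencilLefschetz` (`B⋆(𝒳, η)` for every compact pencil
of abelian `d`-folds `f : 𝒳 ⟶ S` and EVERY `η`) holds iff every such total space `𝒳` (smooth projective of dimension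
`d + 1`) has SOME polarisation class `η₀` with `StandardConjectureBStar (d + 1) 𝒳 η₀` (§2). Fact-free.
[cite: Andre1996Motifs, §6.3 Remarque 2 (p. 33) and Appendix A (p. 44)] [cite: Kleiman1994StandardConjectures, Thm. 4-1] -/
theorem compactAbelianPencilLefschetz_iff_exists_isPolarizationClass :
    CompactAbelianPencilLefschetz ↔
      ∀ ⦃d : ℕ⦄ ⦃𝒳 S : SchemeOver ℂ⦄ (f : 𝒳 ⟶ S), IsCompactAbelianPencil f d →
        ∃ η₀ : complexBetti 𝒳 2, IsPolarizationClass (d + 1) 𝒳 η₀ ∧ StandardConjectureBStar (d + 1) 𝒳 η₀ :=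
  ⟨fun h _ _ _ f hf ↦ (forall_standardConjectureBStar_iff_exists hf.isSmoothProjective_total).1 (h f hf),
    fun h _ _ _ f hf ↦ (forall_standardConjectureBStar_iff_exists hf.isSmoothProjective_total).2 (h f hf)⟩

/-- **`X ⟺ ν_pen`** — the modulus of row b05 in Kleiman's form: `CompactAbelianPencilLefschetz` holds iff for every
compact pencil of abelian `d`-folds `f : 𝒳 ⟶ S` and all `2 ≤ b`, `b + r = d + 1`, `0 < r` (i.e. `2 ≤ b ≤ d`) some
injective linear map `H^{b+2r}(𝒳(ℂ); ℂ) → Hᵇ(𝒳(ℂ); ℂ)` is induced by an algebraic correspondence on `𝒳 × 𝒳`. No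
polarisation, no `*_L`, no hard-Lefschetz inverse on the right-hand side. Fact-free; `X` stays OPEN.
[cite: Andre1996Motifs, §6.3 Remarque 2 (p. 33)] [cite: Kleiman1994StandardConjectures, Thm. 4-1 (ν(X) ⇔ B(X))]
[cite: Milne2020LefschetzStandardFiniteFields, proof of Prop. 4.1 and Rem. 6.3] -/
theorem compactAbelianPencilLefschetz_iff_nu :
    CompactAbelianPencilLefschetz ↔
      ∀ ⦃d : ℕ⦄ ⦃𝒳 S : SchemeOver ℂ⦄ (f : 𝒳 ⟶ S), IsCompactAbelianPencil f d →
        ∀ b r : ℕ, 2 ≤ b → b + r = d + 1 → 0 < r →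
          ∃ F : complexBetti 𝒳 (b + 2 * r) →ₗ[ℂ] complexBetti 𝒳 b,
            IsAlgebraicCorrespondence (d + 1) (d + 1) 𝒳 𝒳 F ∧ Function.Injective F :=
  ⟨fun h _ _ _ f hf ↦ (forall_standardConjectureBStar_iff_nu hf.isSmoothProjective_total).1 (h f hf),
    fun h _ _ _ f hf ↦ (forall_standardConjectureBStar_iff_nu hf.isSmoothProjective_total).2 (h f hf)⟩

/-- The same for the AbelianAll spelling `LefschetzBCompactPencils` (= `CompactAbelianPencilLefschetz` definitionally,
`AbelianAll.lefschetzBCompactPencils_iff_compactAbelianPencilLefschetz`): **(5∀) `⟺ ν_pen`**.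
[cite: Andre1996Motifs, §6.3 Remarque 2 (p. 33)] [cite: Kleiman1994StandardConjectures, Thm. 4-1] -/
theorem lefschetzBCompactPencils_iff_nu :
    LefschetzBCompactPencils ↔
      ∀ ⦃d : ℕ⦄ ⦃𝒳 S : SchemeOver ℂ⦄ (f : 𝒳 ⟶ S), IsCompactAbelianPencil f d →
        ∀ b r : ℕ, 2 ≤ b → b + r = d + 1 → 0 < r →
          ∃ F : complexBetti 𝒳 (b + 2 * r) →ₗ[ℂ] complexBetti 𝒳 b,
            IsAlgebraicCorrespondence (d + 1) (d + 1) 𝒳 𝒳 F ∧ Function.Injective F :=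
  compactAbelianPencilLefschetz_iff_nu

/-- **The graded node `(5∀)_d ⟺ ν` on the `(d+1)`-fold total spaces of the compact pencils of abelian `d`-folds.**
[cite: Andre1996Motifs, §6.3 Remarque 2 (p. 33)] [cite: Kleiman1994StandardConjectures, Thm. 4-1] -/
theorem lefschetzBCompactPencilsAtRelDim_iff_nu (d : ℕ) :
    LefschetzBCompactPencilsAtRelDim d ↔
      ∀ ⦃𝒳 S : SchemeOver ℂ⦄ (f : 𝒳 ⟶ S), IsCompactAbelianPencil f d →
        ∀ b r : ℕ, 2 ≤ b → b + r = d + 1 → 0 < r →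
          ∃ F : complexBetti 𝒳 (b + 2 * r) →ₗ[ℂ] complexBetti 𝒳 b,
            IsAlgebraicCorrespondence (d + 1) (d + 1) 𝒳 𝒳 F ∧ Function.Injective F :=
  ⟨fun h _ _ f hf ↦ (forall_standardConjectureBStar_iff_nu hf.isSmoothProjective_total).1 (h f hf),
    fun h _ _ f hf ↦ (forall_standardConjectureBStar_iff_nu hf.isSmoothProjective_total).2 (h f hf)⟩

/-- **The first open rung `(5∀)_2` is ONE correspondence per pencil**: `B` for the threefold total spaces of the compact
pencils of abelian SURFACES holds iff every such `𝒳` carries an injective linear map `H⁴(𝒳(ℂ); ℂ) → H²(𝒳(ℂ); ℂ)`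
induced by an algebraic class on `𝒳 × 𝒳` (the single degree `b = 2`, `r = 1`; cf. the layer's
`standardConjectureBStar_threefold_of_codimTwo`: the Hodge conjecture in codimension `2` for `𝒳 × 𝒳` supplies
`*_L` itself). In print this rung is settled — the total space has Kodaira dimension `≤ 1` and `B` holds for complex
projective threefolds of Kodaira dimension `< 3` (Tankeev 2011, as recorded on the node `CompactAbelianPencilLefschetz`)
— but not in the tree. [cite: Andre1996Motifs, §6.3 Remarque 2 (p. 33)] [cite: Kleiman1994StandardConjectures, Thm. 4-1]
[cite: Tankeev2011, main theorem (κ < 3)] -/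
theorem lefschetzBCompactPencilsAtRelDim_two_iff_nu :
    LefschetzBCompactPencilsAtRelDim 2 ↔
      ∀ ⦃𝒳 S : SchemeOver ℂ⦄ (f : 𝒳 ⟶ S), IsCompactAbelianPencil f 2 →
        ∃ F : complexBetti 𝒳 4 →ₗ[ℂ] complexBetti 𝒳 2,
          IsAlgebraicCorrespondence 3 3 𝒳 𝒳 F ∧ Function.Injective F := by
  rw [lefschetzBCompactPencilsAtRelDim_iff_nu]
  refine ⟨fun h 𝒳 S f hf ↦ h f hf 2 1 le_rfl rfl one_pos, fun h 𝒳 S f hf b r hb hbr hr ↦ ?_⟩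
  obtain ⟨rfl, rfl⟩ : b = 2 ∧ r = 1 := ⟨by omega, by omega⟩
  exact h f hf

/-- **The CM-pointed node (5) `⟺ ν` on the CM-pointed compact abelian pencils** (`cmLocus f d` non-empty; the
pencils of André's Lemme 6.3.1 are such). [cite: Andre1996Motifs, Lemme 6.3.1 (p. 31) and Remarque 2 (p. 33)]
[cite: Kleiman1994StandardConjectures, Thm. 4-1] -/
theorem lefschetzBCMPointedPencils_iff_nu :
    LefschetzBCMPointedPencils ↔
      ∀ ⦃d : ℕ⦄ ⦃𝒳 S : SchemeOver ℂ⦄ (f : 𝒳 ⟶ S), IsCompactAbelianPencil f d → (cmLocus f d).Nonempty →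
        ∀ b r : ℕ, 2 ≤ b → b + r = d + 1 → 0 < r →
          ∃ F : complexBetti 𝒳 (b + 2 * r) →ₗ[ℂ] complexBetti 𝒳 b,
            IsAlgebraicCorrespondence (d + 1) (d + 1) 𝒳 𝒳 F ∧ Function.Injective F :=
  ⟨fun h _ _ _ f hf hcm ↦ (forall_standardConjectureBStar_iff_nu hf.isSmoothProjective_total).1 (h f hf hcm),
    fun h _ _ _ f hf hcm ↦ (forall_standardConjectureBStar_iff_nu hf.isSmoothProjective_total).2 (h f hf hcm)⟩

end Pencils

/-! ## §4 Row b05 and the cell deliverable with `ν` in place of `X` -/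

section RowB05

/-- **Row b05 `⟸ ν_pen`, modulo the printed binders `h₂₁ h₂₂`** of the landed bridge `X ⟹ b05`
(`AbelianAll.motivatedImpliesAlgebraicAV_of_abdulali_of_andre1996_of_compactAbelianPencilLefschetz_holds`, whose
Abdulali binder `h₈` is the tree theorem `AbelianAll.abdulali1994_holds` since part XXII-d): injective algebraic
correspondences `H^{2d+2-b}(𝒳) → Hᵇ(𝒳)`, `2 ≤ b ≤ d`, on every compact abelian pencil total space give "motivated ⟹
algebraic" on every complex abelian variety. `HC_CM` does not occur. Row b05 stays OPEN ("published modulo `X`").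
[cite: Andre1996Motifs, §6.2 (p. 31), Lemme 6.3.1 and Remarque 2 (p. 33)] [cite: Abdulali1994FamiliesAV, pp. 1122–1123]
[cite: Kleiman1994StandardConjectures, Thm. 4-1] -/
theorem motivatedImpliesAlgebraicAV_of_andre1996_of_nu_compactPencils (h₂₁ : andre1996_cmAnchoredPencil)
    (h₂₂ : andre1996_cmHodgeClasses_algebraicallyAnchoredPencils)
    (hν : ∀ ⦃d : ℕ⦄ ⦃𝒳 S : SchemeOver ℂ⦄ (f : 𝒳 ⟶ S), IsCompactAbelianPencil f d →
      ∀ b r : ℕ, 2 ≤ b → b + r = d + 1 → 0 < r →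
        ∃ F : complexBetti 𝒳 (b + 2 * r) →ₗ[ℂ] complexBetti 𝒳 b,
          IsAlgebraicCorrespondence (d + 1) (d + 1) 𝒳 𝒳 F ∧ Function.Injective F) :
    MotivatedImpliesAlgebraicAV :=
  motivatedImpliesAlgebraicAV_of_abdulali_of_andre1996_of_compactAbelianPencilLefschetz_holds abdulali1994_holds h₂₁ h₂₂
    (compactAbelianPencilLefschetz_iff_nu.2 hν)

/-- **Row b05 `⟸ ν(A × Y)` for every complex abelian variety `A` and every smooth projective `Y`** (gen 31's
`motivatedImpliesAlgebraicAV_of_standardConjectureBStar_abelian_tensor` asked `B⋆(A ⊗ Y, η)` for EVERY polarisation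
class `η` of `A ⊗ Y`; by §1 injective algebraic correspondences `H^{b+2r}((A ⊗ Y)(ℂ)) → Hᵇ((A ⊗ Y)(ℂ))`, `2 ≤ b`,
`b + r = dim A + dim Y`, `0 < r`, suffice). Fact-free; `HC_CM` does not occur.
[cite: Andre1996Motifs, §2.1 remark following Déf. 1 (p. 14)] [cite: Kleiman1994StandardConjectures, Thm. 4-1] -/
theorem motivatedImpliesAlgebraicAV_of_nu_abelian_tensor
    (hν : ∀ (A : AbelianVariety ℂ) (m : ℕ) (Y : SchemeOver ℂ), IsSmoothProjective m Y →
      ∀ b r : ℕ, 2 ≤ b → b + r = A.dim + m → 0 < r →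
        ∃ F : complexBetti (A.X ⊗ Y) (b + 2 * r) →ₗ[ℂ] complexBetti (A.X ⊗ Y) b,
          IsAlgebraicCorrespondence (A.dim + m) (A.dim + m) (A.X ⊗ Y) (A.X ⊗ Y) F ∧ Function.Injective F) :
    MotivatedImpliesAlgebraicAV :=
  motivatedImpliesAlgebraicAV_of_standardConjectureBStar_abelian_tensor fun A m Y η hY ↦
    standardConjectureBStar_of_nu (IsSmoothProjective.tensor_holds (AbelianVariety.isSmoothProjective_holds (A := A)) hY)
      (hν A m Y hY) η

/-- **Row b05 `⟸` ONE polarisation class `η₀` of each `A ⊗ Y` with `B⋆(A ⊗ Y, η₀)`** (`A` complex abelian, `Y` smooth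
projective) — the one-polarisation form of gen 31's `B(A × Y)`-input (§2). Fact-free.
[cite: Andre1996Motifs, §2.1 (p. 14) and Appendix A (p. 44)] -/
theorem motivatedImpliesAlgebraicAV_of_exists_isPolarizationClass_abelian_tensor
    (hB : ∀ (A : AbelianVariety ℂ) (m : ℕ) (Y : SchemeOver ℂ), IsSmoothProjective m Y →
      ∃ η₀ : complexBetti (A.X ⊗ Y) 2, IsPolarizationClass (A.dim + m) (A.X ⊗ Y) η₀ ∧
        StandardConjectureBStar (A.dim + m) (A.X ⊗ Y) η₀) :
    MotivatedImpliesAlgebraicAV :=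
  motivatedImpliesAlgebraicAV_of_standardConjectureBStar_abelian_tensor fun A m Y η hY ↦ by
    obtain ⟨η₀, hη₀, h₀⟩ := hB A m Y hY
    exact standardConjectureBStar_of_isPolarizationClass
      (IsSmoothProjective.tensor_holds (AbelianVariety.isSmoothProjective_holds (A := A)) hY) hη₀ h₀ η

/-- **The Lefschetz-flavoured cell deliverable with `ν` in place of (5): `HC_CM ∧ ν_pen^CM ⟹ HC_AV` modulo André's
Lemme 6.3.1 (`h₂₁`) only** (part XXII-d's `HC_AV_of_HC_CM_of_lefschetzBCMPointedPencils` precomposed with §3): granted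
`HC_CM` (the cell's binder `Theses.RankFourFaces.CMAbelianHodge`, by name, LOAD-BEARING here), injective algebraic
correspondences `H^{2d+2-b}(𝒳) → Hᵇ(𝒳)`, `2 ≤ b ≤ d`, on the total space of every CM-POINTED compact pencil of abelian
`d`-folds give the Hodge conjecture for all complex abelian varieties. research route conditional on HC_CM; not a
corollary. [cite: Andre1996Motifs, Lemme 6.3.1 (p. 31) and Remarque 2 (p. 33)] [cite: Abdulali1994FamiliesAV, p. 1122]
[cite: Kleiman1994StandardConjectures, Thm. 4-1] -/
theorem hc_av_of_hc_cm_of_nu_cmPointedPencils (h₂₁ : andre1996_cmAnchoredPencil) (hCM : RankFourFaces.CMAbelianHodge)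
    (hν : ∀ ⦃d : ℕ⦄ ⦃𝒳 S : SchemeOver ℂ⦄ (f : 𝒳 ⟶ S), IsCompactAbelianPencil f d → (cmLocus f d).Nonempty →
      ∀ b r : ℕ, 2 ≤ b → b + r = d + 1 → 0 < r →
        ∃ F : complexBetti 𝒳 (b + 2 * r) →ₗ[ℂ] complexBetti 𝒳 b,
          IsAlgebraicCorrespondence (d + 1) (d + 1) 𝒳 𝒳 F ∧ Function.Injective F) :
    PadicSemiregularLift.HodgeAbelianVarieties :=
  HC_AV_of_HC_CM_of_lefschetzBCMPointedPencils h₂₁ hCM (lefschetzBCMPointedPencils_iff_nu.2 hν)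

end RowB05

end Summit.HodgeConjecture.HodgeConjecture.Ring2.Hypotheses

end
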